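import Summits.AtomisticToContinuum.HydrodynamicLimit.Theorems.RelayRaceLocalityNearConstantShortTimeHLAssemblyTheta
import Summits.AtomisticToContinuum.HydrodynamicLimit.Theorems.RelayRaceLocalityNearConstantShortTimeHLEntropyFluxRemainder
import Summits.AtomisticToContinuum.HydrodynamicLimit.Theorems.RelayRaceLocalityNearConstantShortTimeHLBallKinetics
import Summits.AtomisticToContinuum.HydrodynamicLimit.Theorems.RelayRaceLocalityNearConstantShortTimeHLCommutators
import HarnessLib

/-!
# Crux `NearConstantShortTimeHL` (stmt-AtomisticToContinuum-12502), line `small-tilt-domination`: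
# the flux-remainder integral bound — helpers (pointwise sizes of the entropy-rate density)

Support file for the registered stub `integral_abs_ballRate_sub_eulerRate_le` of the Grönwall
assembly (lead c3, wave 2; the stub itself is proved in
`RelayRaceLocalityNearConstantShortTimeHLFluxRemainder.lean`, which imports this file). The entropy-rate density
`Θ_r(x)(W) = ∂ₜλ⁰ ρ' + Σⱼ ∂ₜλⱼ m'ⱼ + ∂ₜλ⁴ E' + Σₖ ∂ₖλ⁰ m'ₖ + Σₖⱼ ∂ₖλⱼ (m'ₖm'ⱼ/ρ' + δₖⱼ p') +
Σₖ ∂ₖλ⁴ (E' + p') m'ₖ/ρ'` (`entropyRate`) is, on BAD balls, bounded only crudely; this file supplies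
the crude pointwise sizes and the measurability needed to integrate them:

* `wb_abs_rateForm_le`: if the six coefficient families are `≤ Λ` in absolute value and the
  state `(ρ', m', E')` is KINETIC (`ρ', E' ≥ 0`, `‖m'‖² ≤ 2ρ'E'`, `‖m'‖ ≤ ρ'/2 + E'`,
  `E'‖m'‖ ≤ ρ' c/2`) with compressibility `|Z(ρ'σ³)| ≤ Z_m`, then
  `|Θ(W)| ≤ Λ (25 + 6 Z_m) (ρ' + E' + c)` (the pressure of a kinetic state is `≤ (2/3) Z_m E'`);
* `wb_abs_ballRate_le` (registered WB intermediate): the ball averages of a configuration are a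
  kinetic state with `c = c̃ = n⁻¹Σ kᵢ‖vᵢ‖³` (`norm_ballMomentum_sq_le`, `norm_ballMomentum_le`,
  `ballEnergy_mul_norm_ballMomentum_le`), so `|ballRate| ≤ Λ (25 + 6 Z_m)(ρ̃ + ẽ + c̃)`;
* `wb_abs_eulerRate_le`: the Euler state is kinetic with `c = 2E‖u‖`, so `|eulerRate| ≤ C_E`;
* `wb_exists_compressibility_bound`: `Z = 1 + η F′` is bounded on `[0, η'] ⊂ [0, η₀)`;
* `wb_measurable_entropyRate` and the measurability / integrability of the ball fields in the
  centre `x` (finite sums of indicators of measurable balls).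

No definitions, no named facts. References: H.-T. Yau, Lett. Math. Phys. 22 (1991) §2;
C. M. Dafermos, *Hyperbolic Conservation Laws in Continuum Physics* (2005), Thm 5.2.1.
-/

noncomputable section

namespace Summit.AtomisticToContinuum.HydrodynamicLimit.Theorems.NearConstantShortTimeHL

open scoped BigOperators ENNReal
open MeasureTheory Set Filter
open Literature.MathematicalPhysics.KineticTheory Literature.Analysis.FluidPDE Literature.Analysis.FunctionSpaces

/-! ### Elementary inequalities -/

/-- Triangle inequality for six summands. [folklore] -/
theorem wb_abs_add_six (a b c d e f : ℝ) :
    |a + b + c + d + e + f| ≤ |a| + |b| + |c| + |d| + |e| + |f| := by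
  have h1 := abs_add_le (a + b + c + d + e) f
  have h2 := abs_add_le (a + b + c + d) e
  have h3 := abs_add_le (a + b + c) d
  have h4 := abs_add_le (a + b) c
  have h5 := abs_add_le a b
  linarith

/-! ### The crude size of the entropy-rate density at a kinetic state -/

/-- **Crude size of the entropy-rate form at a kinetic state.** For coefficients bounded by `Λ`
and a state `(ρ', m', E')` with `ρ', E' ≥ 0`, `‖m'‖² ≤ 2ρ'E'`, `‖m'‖ ≤ ρ'/2 + E'`,
`E'‖m'‖ ≤ (ρ'/2) c` and `|Z(ρ'σ³)| ≤ Z_m`: the pressure `p' = ρ' θ(W) Z` satisfies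
`|p'| ≤ (2/3) Z_m E'`, the quadratic momentum flux `|m'ₖm'ⱼ|/ρ' ≤ 2E'`, the energy flux
`|(E' + p') m'ₖ|/ρ' ≤ (1 + (2/3)Z_m) c/2`, whence the whole form is
`≤ Λ (25 + 6 Z_m)(ρ' + E' + c)` (Lean's `x/0 = 0` covers `ρ' = 0`). [cite: Yau1991, §2] -/
theorem wb_abs_rateForm_le {σ Λ Zm ρ' E' c a0 a4 : ℝ} {a1 m' : V3} {b0 b4 : Fin 3 → ℝ}
    {b1 : Fin 3 → V3}
    (hA0 : |a0| ≤ Λ) (hA : ∀ j, |a1 j| ≤ Λ) (hA4 : |a4| ≤ Λ) (hB : ∀ k, |b0 k| ≤ Λ)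
    (hC : ∀ k j, |b1 k j| ≤ Λ) (hD : ∀ k, |b4 k| ≤ Λ)
    (hρ' : 0 ≤ ρ') (hE' : 0 ≤ E') (hc : 0 ≤ c) (hZm : 0 ≤ Zm)
    (hCS : ‖m'‖ ^ 2 ≤ 2 * ρ' * E') (hm : ‖m'‖ ≤ ρ' / 2 + E') (hEm : E' * ‖m'‖ ≤ ρ' / 2 * c)
    (hZ : |hsCompressibility (ρ' * σ ^ 3)| ≤ Zm) :
    |a0 * ρ' + (∑ j, a1 j * m' j) + a4 * E' + (∑ k, b0 k * m' k) +
        (∑ k, ∑ j, b1 k j *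
          (m' k * m' j / ρ' + if k = j then hsPressure σ ρ' (stateTemp ρ' E' m') else 0)) +
        ∑ k, b4 k * ((E' + hsPressure σ ρ' (stateTemp ρ' E' m')) * m' k / ρ')| ≤
      Λ * (25 + 6 * Zm) * (ρ' + E' + c) := by
  have hΛ : 0 ≤ Λ := (abs_nonneg _).trans hA0
  have hn : 0 ≤ ‖m'‖ := norm_nonneg _
  have hmj : ∀ j, |m' j| ≤ ‖m'‖ := fun j => by
    have h := PiLp.norm_apply_le m' j
    rwa [Real.norm_eq_abs] at h
  -- the pressure of the state
  set p' : ℝ := hsPressure σ ρ' (stateTemp ρ' E' m') with hp'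
  have hp : |p'| ≤ 2 / 3 * Zm * E' := by
    rcases hρ'.eq_or_lt with h0 | hpos
    · have h : p' = 0 := by rw [hp', hsPressure, ← h0]; ring
      rw [h, abs_zero]
      positivity
    · have hq : p' = 2 / 3 * (E' - ‖m'‖ ^ 2 / (2 * ρ')) * hsCompressibility (ρ' * σ ^ 3) := by
        rw [hp', hsPressure, stateTemp]
        field_simp
      have hq0 : 0 ≤ E' - ‖m'‖ ^ 2 / (2 * ρ') := by
        rw [sub_nonneg, div_le_iff₀ (by positivity)]
        linarith
      have hq2 : 0 ≤ ‖m'‖ ^ 2 / (2 * ρ') := by positivity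
      rw [hq, abs_mul, abs_of_nonneg (by positivity : (0 : ℝ) ≤ 2 / 3 * (E' - ‖m'‖ ^ 2 / (2 * ρ')))]
      calc 2 / 3 * (E' - ‖m'‖ ^ 2 / (2 * ρ')) * |hsCompressibility (ρ' * σ ^ 3)|
          ≤ 2 / 3 * E' * Zm := mul_le_mul (by linarith) hZ (abs_nonneg _) (by positivity)
        _ = 2 / 3 * Zm * E' := by ring
  have hp0 : 0 ≤ |p'| := abs_nonneg _
  -- the quadratic momentum flux
  have hsq : ‖m'‖ ^ 2 / ρ' ≤ 2 * E' := by
    rcases hρ'.eq_or_lt with h0 | hpos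
    · rw [← h0, div_zero]; linarith
    · rw [div_le_iff₀ hpos]; linarith
  have hquad : ∀ k j, |m' k * m' j / ρ'| ≤ 2 * E' := fun k j => by
    rw [abs_div, abs_mul, abs_of_nonneg hρ']
    refine le_trans ?_ hsq
    rw [sq]
    exact div_le_div_of_nonneg_right (mul_le_mul (hmj k) (hmj j) (abs_nonneg _) hn) hρ'
  have hite : ∀ k j : Fin 3, |(if k = j then p' else 0)| ≤ |p'| := fun k j => by
    by_cases h : k = j <;> simp [h]
  -- the energy flux
  have hflux : ∀ k, |(E' + p') * m' k / ρ'| ≤ (1 + 2 / 3 * Zm) * (c / 2) := fun k => by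
    rcases hρ'.eq_or_lt with h0 | hpos
    · rw [← h0, div_zero, abs_zero]; positivity
    · rw [abs_div, abs_mul, abs_of_pos hpos, div_le_iff₀ hpos]
      have h1 : |E' + p'| ≤ (1 + 2 / 3 * Zm) * E' := by
        calc |E' + p'| ≤ |E'| + |p'| := abs_add_le _ _
          _ ≤ E' + 2 / 3 * Zm * E' := by rw [abs_of_nonneg hE']; linarith
          _ = (1 + 2 / 3 * Zm) * E' := by ring
      calc |E' + p'| * |m' k| ≤ (1 + 2 / 3 * Zm) * E' * ‖m'‖ :=
            mul_le_mul h1 (hmj k) (abs_nonneg _) (by positivity)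
        _ = (1 + 2 / 3 * Zm) * (E' * ‖m'‖) := by ring
        _ ≤ (1 + 2 / 3 * Zm) * (ρ' / 2 * c) := mul_le_mul_of_nonneg_left hEm (by positivity)
        _ = (1 + 2 / 3 * Zm) * (c / 2) * ρ' := by ring
  -- the six groups of terms
  have t1 : |a0 * ρ'| ≤ Λ * ρ' := by
    rw [abs_mul, abs_of_nonneg hρ']
    exact mul_le_mul_of_nonneg_right hA0 hρ'
  have t2 : |∑ j, a1 j * m' j| ≤ 3 * (Λ * ‖m'‖) := by
    refine (Finset.abs_sum_le_sum_abs _ _).trans ?_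
    calc ∑ j, |a1 j * m' j| ≤ ∑ _j : Fin 3, Λ * ‖m'‖ := Finset.sum_le_sum fun j _ => by
          rw [abs_mul]; exact mul_le_mul (hA j) (hmj j) (abs_nonneg _) hΛ
      _ = 3 * (Λ * ‖m'‖) := by rw [Fin.sum_univ_three]; ring
  have t3 : |a4 * E'| ≤ Λ * E' := by
    rw [abs_mul, abs_of_nonneg hE']
    exact mul_le_mul_of_nonneg_right hA4 hE'
  have t4 : |∑ k, b0 k * m' k| ≤ 3 * (Λ * ‖m'‖) := by
    refine (Finset.abs_sum_le_sum_abs _ _).trans ?_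
    calc ∑ k, |b0 k * m' k| ≤ ∑ _k : Fin 3, Λ * ‖m'‖ := Finset.sum_le_sum fun k _ => by
          rw [abs_mul]; exact mul_le_mul (hB k) (hmj k) (abs_nonneg _) hΛ
      _ = 3 * (Λ * ‖m'‖) := by rw [Fin.sum_univ_three]; ring
  have t5 : |∑ k, ∑ j, b1 k j * (m' k * m' j / ρ' + if k = j then p' else 0)| ≤
      9 * (Λ * (2 * E' + |p'|)) := by
    refine (Finset.abs_sum_le_sum_abs _ _).trans ?_
    calc ∑ k, |∑ j, b1 k j * (m' k * m' j / ρ' + if k = j then p' else 0)|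
        ≤ ∑ _k : Fin 3, 3 * (Λ * (2 * E' + |p'|)) := Finset.sum_le_sum fun k _ => by
          refine (Finset.abs_sum_le_sum_abs _ _).trans ?_
          calc ∑ j, |b1 k j * (m' k * m' j / ρ' + if k = j then p' else 0)|
              ≤ ∑ _j : Fin 3, Λ * (2 * E' + |p'|) := Finset.sum_le_sum fun j _ => by
                rw [abs_mul]
                refine mul_le_mul (hC k j) ?_ (abs_nonneg _) hΛ
                exact (abs_add_le _ _).trans (add_le_add (hquad k j) (hite k j))
            _ = 3 * (Λ * (2 * E' + |p'|)) := by rw [Fin.sum_univ_three]; ring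
      _ = 9 * (Λ * (2 * E' + |p'|)) := by rw [Fin.sum_univ_three]; ring
  have t6 : |∑ k, b4 k * ((E' + p') * m' k / ρ')| ≤ 3 * (Λ * ((1 + 2 / 3 * Zm) * (c / 2))) := by
    refine (Finset.abs_sum_le_sum_abs _ _).trans ?_
    calc ∑ k, |b4 k * ((E' + p') * m' k / ρ')| ≤ ∑ _k : Fin 3, Λ * ((1 + 2 / 3 * Zm) * (c / 2)) :=
          Finset.sum_le_sum fun k _ => by
            rw [abs_mul]; exact mul_le_mul (hD k) (hflux k) (abs_nonneg _) hΛ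
      _ = 3 * (Λ * ((1 + 2 / 3 * Zm) * (c / 2))) := by rw [Fin.sum_univ_three]; ring
  -- assembly
  have hm' : Λ * ‖m'‖ ≤ Λ * (ρ' / 2 + E') := mul_le_mul_of_nonneg_left hm hΛ
  have hp'' : Λ * |p'| ≤ Λ * (2 / 3 * Zm * E') := mul_le_mul_of_nonneg_left hp hΛ
  have k1 : 0 ≤ Λ * ρ' := mul_nonneg hΛ hρ'
  have k2 : 0 ≤ Λ * c := mul_nonneg hΛ hc
  have k3 : 0 ≤ Λ * Zm * ρ' := mul_nonneg (mul_nonneg hΛ hZm) hρ'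
  have k4 : 0 ≤ Λ * Zm * c := mul_nonneg (mul_nonneg hΛ hZm) hc
  refine (wb_abs_add_six _ _ _ _ _ _).trans ?_
  linarith [t1, t2, t3, t4, t5, t6, hm', hp'', k1, k2, k3, k4]

/-! ### The compressibility factor is bounded on compact packing intervals -/

/-- On `[0, η'] ⊂ [0, η₀)` the compressibility factor `Z(η) = 1 + η f_ex′(η) = 1 + η F′(η)`
(`η > 0`; `Z(0) = 1`) is bounded, `F` being analytic on `(-η₀, η₀)`. [folklore] -/
theorem wb_exists_compressibility_bound {η₀ : ℝ} {F : ℝ → ℝ} (hη₀ : 0 < η₀)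
    (hFa : AnalyticOnNhd ℝ F (Set.Ioo (-η₀) η₀)) (hF : Set.EqOn hsExcessFreeEnergy F (Set.Ico 0 η₀))
    {η' : ℝ} (hη' : η' < η₀) :
    ∃ Zm : ℝ, 0 ≤ Zm ∧ ∀ η ∈ Set.Icc 0 η', |hsCompressibility η| ≤ Zm := by
  have hsub : Icc 0 η' ⊆ Ioo (-η₀) η₀ := fun η hη => ⟨by linarith [hη.1], hη.2.trans_lt hη'⟩
  have hcont : ContinuousOn (deriv F) (Icc 0 η') := hFa.deriv.continuousOn.mono hsub
  obtain ⟨M, hM⟩ := isCompact_Icc.exists_bound_of_continuousOn hcont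
  refine ⟨1 + η₀ * |M|, by positivity, fun η hη => ?_⟩
  rcases hη.1.eq_or_lt with h0 | hpos
  · rw [← h0]
    simp only [hsCompressibility, zero_mul, add_zero, abs_one]
    have : 0 ≤ η₀ * |M| := by positivity
    linarith
  · rw [hsCompressibility_eq hF ⟨hpos, hη.2.trans_lt hη'⟩]
    have h1 : |deriv F η| ≤ |M| := by
      have h := hM η hη
      rw [Real.norm_eq_abs] at h
      exact h.trans (le_abs_self M)
    have h2 : η * |deriv F η| ≤ η₀ * |M| :=
      mul_le_mul (hη.2.trans hη'.le) h1 (abs_nonneg _) hη₀.le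
    calc |1 + η * deriv F η| ≤ |(1 : ℝ)| + |η * deriv F η| := abs_add_le _ _
      _ = 1 + η * |deriv F η| := by rw [abs_one, abs_mul, abs_of_pos hpos]
      _ ≤ 1 + η₀ * |M| := by linarith

/-! ### Measurability in the centre of the ball-averaged fields and of the entropy rate -/

/-- Coordinates of a measurable `ℝ³`-valued map are measurable. [folklore] -/
theorem wb_measurable_apply {f : T3 → V3} (hf : Measurable f) (j : Fin 3) :
    Measurable fun x => f x j := by
  fun_prop

/-- The ball kernel is measurable in its centre (indicator of a measurable ball). [folklore] -/
theorem wb_measurable_ballKernel (ℓ : ℝ) (y : T3) : Measurable fun x : T3 => ballKernel ℓ x y := by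
  unfold ballKernel
  exact Measurable.ite (measurableSet_setOf_euclidDist_lt ℓ y) measurable_const measurable_const

/-- Ball averages `x ↦ n⁻¹ Σᵢ ballKernel ℓ x xᵢ · G(vᵢ)` of a fixed configuration are measurable
and integrable in the centre `x`. [folklore] -/
theorem wb_integrable_ballAverage {n : ℕ} (ℓ : ℝ) (w : Config n (Fin 3) T3) (G : V3 → ℝ) :
    Measurable (fun x : T3 => (n : ℝ)⁻¹ * ∑ i, ballKernel ℓ x (w i).1 * G (w i).2) ∧
      Integrable (fun x : T3 => (n : ℝ)⁻¹ * ∑ i, ballKernel ℓ x (w i).1 * G (w i).2) :=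
  ⟨(Finset.measurable_sum _ fun i _ => (wb_measurable_ballKernel ℓ (w i).1).mul_const _).const_mul _,
    (integrable_finsetSum _ fun i _ => (integrable_ballKernel ℓ _ (w i).1).mul_const _).const_mul _⟩

/-- The ball-averaged density, momentum and energy of a fixed configuration are measurable in the
centre. [folklore] -/
theorem wb_measurable_ballFields {n : ℕ} (ℓ : ℝ) (w : Config n (Fin 3) T3) :
    Measurable (fun x : T3 => empiricalDensityField w (ballKernel ℓ x)) ∧
      Measurable (fun x : T3 => empiricalMomentumField w (ballKernel ℓ x)) ∧
      Measurable (fun x : T3 => empiricalEnergyField w (ballKernel ℓ x)) := by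
  have hk : ∀ i : Fin n, Measurable fun x : T3 => ballKernel ℓ x (w i).1 := fun i =>
    wb_measurable_ballKernel ℓ _
  refine ⟨?_, ?_, ?_⟩
  · simp_rw [empiricalDensityField_eq_sum]
    exact (Finset.measurable_sum _ fun i _ => hk i).const_mul _
  · simp_rw [empiricalMomentumField_eq_sum]
    have h2 : Measurable fun x : T3 => ∑ i, ballKernel ℓ x (w i).1 • (w i).2 :=
      Finset.measurable_sum _ fun i _ => (hk i).smul_const ((w i).2)
    exact h2.const_smul ((n : ℝ)⁻¹)
  · simp_rw [empiricalEnergyField_eq_sum]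
    exact (Finset.measurable_sum _ fun i _ => (hk i).mul_const _).const_mul _

/-- **Measurability of the entropy-rate density along measurable states.** If the six coefficient
slices at time `r` are measurable in `x` and `a, e, m` are measurable state fields, then
`x ↦ Θ_r(x)(a(x), m(x), e(x))` is measurable (`deriv f_ex` is measurable, Mathlib
`measurable_deriv`). [folklore] -/
theorem wb_measurable_entropyRate {σ T : ℝ} {ρ θ : ℝ → T3 → ℝ} {u : ℝ → T3 → V3} {r : ℝ}
    (h0 : Measurable fun x => Torus.timeDerivWithin (Set.Ico 0 T) (lam0Row σ ρ θ u) r x)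
    (h1 : Measurable fun x => Torus.timeDerivWithin (Set.Ico 0 T) (lamRow θ u) r x)
    (h4 : Measurable fun x => Torus.timeDerivWithin (Set.Ico 0 T) (lam4Row θ) r x)
    (g0 : ∀ k, Measurable fun x => Torus.partialDeriv k (lam0Row σ ρ θ u r) x)
    (g1 : ∀ k, Measurable fun x => Torus.partialDeriv k (lamRow θ u r) x)
    (g4 : ∀ k, Measurable fun x => Torus.partialDeriv k (lam4Row θ r) x)
    {a e : T3 → ℝ} {m : T3 → V3} (ha : Measurable a) (he : Measurable e) (hm : Measurable m) :
    Measurable fun x => entropyRate σ T ρ θ u r x (a x) (e x) (m x) := by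
  have hP : Measurable fun x => hsPressure σ (a x) (stateTemp (a x) (e x) (m x)) := by
    unfold hsPressure stateTemp hsCompressibility
    have hd : Measurable (deriv hsExcessFreeEnergy) := measurable_deriv _
    fun_prop
  have hmk : ∀ k, Measurable fun x => m x k := fun k => wb_measurable_apply hm k
  unfold entropyRate
  refine (((((h0.mul ha).add ?_).add (h4.mul he)).add ?_).add ?_).add ?_
  · exact Finset.measurable_sum _ fun j _ => (wb_measurable_apply h1 j).mul (hmk j)
  · exact Finset.measurable_sum _ fun k _ => (g0 k).mul (hmk k)
  · refine Finset.measurable_sum _ fun k _ => Finset.measurable_sum _ fun j _ =>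
      (wb_measurable_apply (g1 k) j).mul ?_
    exact (((hmk k).mul (hmk j)).div ha).add
      (Measurable.ite (MeasurableSet.const _) hP measurable_const)
  · exact Finset.measurable_sum _ fun k _ => (g4 k).mul (((he.add hP).mul (hmk k)).div ha)

/-! ### Crude sizes of `ballRate` and `eulerRate` -/

/-- **Crude size of the entropy rate at the ball averages** (registered WB intermediate
`wb_abs_ballRate_le`). With the six coefficient families bounded by `Λ` at `(r, x)` and the
compressibility of the ball-averaged packing bounded by `Z_m`,
`|ballRate| ≤ Λ (25 + 6 Z_m)(ρ̃ + ẽ + c̃)`, `c̃ = n⁻¹ Σᵢ kᵢ ‖vᵢ‖³`: the ball averages are a kinetic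
state (`norm_ballMomentum_sq_le`, `norm_ballMomentum_le`, `ballEnergy_mul_norm_ballMomentum_le`).
[cite: Yau1991, §2] -/
theorem wb_abs_ballRate_le : ∀ {σ T : ℝ} {ρ θ : ℝ → T3 → ℝ} {u : ℝ → T3 → V3} {r : ℝ} {x : T3} {Λ Zm : ℝ}, |Torus.timeDerivWithin (Set.Ico 0 T) (lam0Row σ ρ θ u) r x| ≤ Λ → (∀ j, |Torus.timeDerivWithin (Set.Ico 0 T) (lamRow θ u) r x j| ≤ Λ) → |Torus.timeDerivWithin (Set.Ico 0 T) (lam4Row θ) r x| ≤ Λ → (∀ k, |Torus.partialDeriv k (lam0Row σ ρ θ u r) x| ≤ Λ) → (∀ k j, |Torus.partialDeriv k (lamRow θ u r) x j| ≤ Λ) → (∀ k, |Torus.partialDeriv k (lam4Row θ r) x| ≤ Λ) → 0 ≤ Zm → ∀ {n : ℕ} (ℓ : ℝ) (w : Config n (Fin 3) T3), |hsCompressibility (empiricalDensityField w (ballKernel ℓ x) * σ ^ 3)| ≤ Zm → |ballRate σ T ρ θ u r ℓ w x| ≤ Λ * (25 + 6 * Zm) * (empiricalDensityField w (ballKernel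 ℓ x) + empiricalEnergyField w (ballKernel ℓ x) + (n : ℝ)⁻¹ * ∑ i, ballKernel ℓ x (w i).1 * ‖(w i).2‖ ^ 3) := by
  intro σ T ρ θ u r x Λ Zm hA0 hA hA4 hB hC hD hZm n ℓ w hZ
  have hc : 0 ≤ (n : ℝ)⁻¹ * ∑ i, ballKernel ℓ x (w i).1 * ‖(w i).2‖ ^ 3 :=
    mul_nonneg (inv_nonneg.2 (Nat.cast_nonneg _))
      (Finset.sum_nonneg fun i _ => mul_nonneg (ballKernel_nonneg _ _ _) (by positivity))
  unfold ballRate entropyRate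
  exact wb_abs_rateForm_le hA0 hA hA4 hB hC hD (ballDensity_nonneg ℓ x w) (ballEnergy_nonneg ℓ x w)
    hc hZm (norm_ballMomentum_sq_le ℓ x w) (norm_ballMomentum_le ℓ x w)
    (ballEnergy_mul_norm_ballMomentum_le ℓ x w) hZ

/-- **Crude size of the entropy rate at the Euler state.** With the six coefficient families
bounded by `Λ` at `(r, x)`, `0 < ρ ≤ L`, `‖u‖ ≤ L`, `0 < θ ≤ L` (`L ≥ 1`) and `|Z(ρσ³)| ≤ Z_m`:
`|eulerRate| ≤ Λ (25 + 6 Z_m) · 7L⁴` — the Euler state `(ρ, ρu, E)` is kinetic with `c = 2E‖u‖`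
and `ρ + E + 2E‖u‖ ≤ L + 2L³ + 4L⁴`. [cite: Yau1991, §2] -/
theorem wb_abs_eulerRate_le {σ T : ℝ} {ρ θ : ℝ → T3 → ℝ} {u : ℝ → T3 → V3} {r : ℝ} {x : T3}
    {Λ Zm L : ℝ}
    (hA0 : |Torus.timeDerivWithin (Set.Ico 0 T) (lam0Row σ ρ θ u) r x| ≤ Λ)
    (hA : ∀ j, |Torus.timeDerivWithin (Set.Ico 0 T) (lamRow θ u) r x j| ≤ Λ)
    (hA4 : |Torus.timeDerivWithin (Set.Ico 0 T) (lam4Row θ) r x| ≤ Λ)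
    (hB : ∀ k, |Torus.partialDeriv k (lam0Row σ ρ θ u r) x| ≤ Λ)
    (hC : ∀ k j, |Torus.partialDeriv k (lamRow θ u r) x j| ≤ Λ)
    (hD : ∀ k, |Torus.partialDeriv k (lam4Row θ r) x| ≤ Λ) (hZm : 0 ≤ Zm) (hL : 1 ≤ L)
    (hρ0 : 0 < ρ r x) (hθ0 : 0 < θ r x) (hρL : ρ r x ≤ L) (huL : ‖u r x‖ ≤ L) (hθL : θ r x ≤ L)
    (hZ : |hsCompressibility (ρ r x * σ ^ 3)| ≤ Zm) :
    |eulerRate σ T ρ θ u r x| ≤ Λ * (25 + 6 * Zm) * (7 * L ^ 4) := by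
  have hΛ : 0 ≤ Λ := (abs_nonneg _).trans hA0
  have hE0 : 0 ≤ totalEnergyDensity (ρ r x) (u r x) (θ r x) := by
    unfold totalEnergyDensity; positivity
  have hns : ‖ρ r x • u r x‖ = ρ r x * ‖u r x‖ := by
    rw [norm_smul, Real.norm_eq_abs, abs_of_pos hρ0]
  have hρθ : 0 < ρ r x ^ 2 * θ r x := by positivity
  have hCS : ‖ρ r x • u r x‖ ^ 2 ≤ 2 * ρ r x * totalEnergyDensity (ρ r x) (u r x) (θ r x) := by
    rw [hns, totalEnergyDensity]
    nlinarith [hρθ]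
  have hm : ‖ρ r x • u r x‖ ≤ ρ r x / 2 + totalEnergyDensity (ρ r x) (u r x) (θ r x) := by
    rw [hns, totalEnergyDensity]
    have h1 : ‖u r x‖ ≤ 1 / 2 + ‖u r x‖ ^ 2 / 2 := by nlinarith [sq_nonneg (‖u r x‖ - 1)]
    have h2 := mul_le_mul_of_nonneg_left h1 hρ0.le
    nlinarith [h2, mul_pos hρ0 hθ0]
  have hEm : totalEnergyDensity (ρ r x) (u r x) (θ r x) * ‖ρ r x • u r x‖ ≤
      ρ r x / 2 * (2 * totalEnergyDensity (ρ r x) (u r x) (θ r x) * ‖u r x‖) := by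
    rw [hns]; exact le_of_eq (by ring)
  have hc : 0 ≤ 2 * totalEnergyDensity (ρ r x) (u r x) (θ r x) * ‖u r x‖ := by positivity
  have key := wb_abs_rateForm_le hA0 hA hA4 hB hC hD hρ0.le hE0 hc hZm hCS hm hEm hZ
  unfold eulerRate entropyRate
  refine key.trans (mul_le_mul_of_nonneg_left ?_ (by positivity))
  have hEuL : totalEnergyDensity (ρ r x) (u r x) (θ r x) ≤ 2 * L ^ 3 :=
    (le_abs_self _).trans (abs_totalEnergyDensity_le hL (by rw [abs_of_pos hρ0]; exact hρL) huL
      (by rw [abs_of_pos hθ0]; exact hθL))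
  have h1 : L ≤ L ^ 4 := le_self_pow₀ hL (by norm_num)
  have h3 : L ^ 3 ≤ L ^ 4 := pow_le_pow_right₀ hL (by norm_num)
  have h4 : totalEnergyDensity (ρ r x) (u r x) (θ r x) * ‖u r x‖ ≤ 2 * L ^ 3 * L :=
    mul_le_mul hEuL huL (norm_nonneg _) (by positivity)
  nlinarith [h1, h3, h4, hρL, hEuL]

end Summit.AtomisticToContinuum.HydrodynamicLimit.Theorems.NearConstantShortTimeHL

end
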